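import Summits.CriticalPhenomena.CardyFormulaZ2.Theorems.CardyComplexConeEdgePrecompactUFRSStrands

/-!
# The arms of a strand under Dobrushin boundary conditions
(line `qkz-strip-boundary-arm` of crux `CardyComplexCone.EdgePrecompact`, stmt-CriticalPhenomena-11387;
item 3 of the road map for the uniform forward response stability "UFRS", module docstring of
`Theorems/CardyComplexConeEdgePrecompactUniformForwardResponseStability.lean`: the dictionary between
the arms of a medial strand of the COMPLETED configuration and arms of `ω` with Dobrushin boundary
conditions)

`exists_orbitArms` (`…EdgePrecompactUFRSStrands.lean`) attaches to every stretch `O c [i, j]` of an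
orbit of Smirnov's successor map in a configuration `β` an open walk on its left (edges `∈ β`) and a
dual walk on its right (steps crossing edges `∉ β`). In UFRS the configuration is the completed one,
`β = E.bcBondConfig ω` (edges of the discrete domain `Ω_δ`; wired on the arc `A`, free along the arc
`B`, equal to `ω` elsewhere), and the strands run through inner faces of `E`. This file reads the two
walks in terms of `ω` and the data (`strandArms`, registered sub-goal `ufrs_strandArms`):
* the LEFT walk is a walk of the discrete domain graph each of whose edges is `ω`-open or has both
  ends on the wired arc `A`, and none of whose edges touches the free arc `B` — an open arm of `ω`
  for the Dobrushin boundary condition (open primal edges, riding the wired arc where it touches `∂`);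
* the RIGHT walk runs through INNER faces of `E`, and each of its steps crosses an edge of the
  discrete domain which is `ω`-closed or touches the free arc `B`, and does not have both ends on
  `A` — a dual arm of `ω` for the Dobrushin boundary condition (dual-open edges, riding the free arc);
* `far_of_cTgt_mem_ball`: a strand from a collar corner (depth `< 3η`) to the ball `B(E.δ v, ρ)`
  (centre `2ρ`-deep) reaches euclidean distance `> ρ - 3η - E.δ` from its collar end — the arms are
  LONG (from scale `E.δ` at the collar box to scale `ρ`).
At `3η`-deep sites the completed statuses are the `ω`-statuses and all faces are inner
(`collarAgreement`), so away from the collar these are plain open / dual-open arms of `ω`.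

References: S. Smirnov, C. R. Acad. Sci. Paris 333 (2001), §2; G. Grimmett, *Percolation* (1999),
§11.2; P. Nolin, Electron. J. Probab. 13 (2008), §4.6 (arms in a half-plane).
-/

namespace Summit.CriticalPhenomena.CardyFormulaZ2.Cruxes.EdgePrecompact.QkzStripBoundaryArm

open MeasureTheory Filter Set Metric
open scoped Topology BigOperators Pointwise
open Literature.Probability.LatticeModels Literature.Probability.Percolation
open Literature.Probability.RandomPlanarGeometry (DobrushinDomain)
open Summit.CriticalPhenomena.CardyFormulaZ2.Theses.CardyComplexCone

noncomputable section

/-! ## Reading completed statuses -/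

/-- An edge of the completed configuration is an edge of the discrete domain, `ω`-open or wired
(both ends on the arc `A`), and does not touch the free arc `B` (for admissible data, whose arcs are
disjoint). -/
theorem mem_bcBondConfig_cases {E : DiscreteDobrushin} (hE : E.IsZdAdmissible) {ω : BondConfig (Site 2)}
    {e : Sym2 (Site 2)} (he : e ∈ E.bcBondConfig ω) :
    e ∈ (discreteDomainGraph E.Ω E.δ).edgeSet ∧ (e ∈ ω ∨ ∀ x ∈ e, x ∈ E.zdArcA) ∧ ∀ x ∈ e, x ∉ E.zdArcB := by
  obtain ⟨hdom, hA | ⟨hω, hB⟩⟩ := he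
  · exact ⟨hdom, Or.inr hA, fun x hx hxB => Set.disjoint_left.1 hE.disjoint (hA x hx) hxB⟩
  · exact ⟨hdom, Or.inl hω, hB⟩

/-- The target edge of a corner with inner face is an edge of the discrete domain (a side of that
face). -/
theorem cTgt_mem_edgeSet_of_isInnerFace {E : DiscreteDobrushin} {p : Site 2 × Fin 4}
    (hp : E.IsInnerFace (cFace p)) : cTgt p ∈ (discreteDomainGraph E.Ω E.δ).edgeSet := by
  rw [cTgt, SimpleGraph.mem_edgeSet]
  exact DiscreteDobrushin.adj_of_isInnerFace_faceAt (k := p.2 + 1) (j := p.2) hp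
    (Or.inr (fin4_add_one_add_three p.2).symm)

/-- A domain edge outside the completed configuration is `ω`-closed or touches the free arc `B`, and
is not wired. -/
theorem not_mem_bcBondConfig_cases {E : DiscreteDobrushin} {ω : BondConfig (Site 2)} {e : Sym2 (Site 2)}
    (hdom : e ∈ (discreteDomainGraph E.Ω E.δ).edgeSet) (he : e ∉ E.bcBondConfig ω) :
    (e ∉ ω ∨ ∃ x ∈ e, x ∈ E.zdArcB) ∧ ¬ ∀ x ∈ e, x ∈ E.zdArcA := by
  rw [DiscreteDobrushin.mem_bcBondConfig_iff, not_and_or] at he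
  rcases he with he | he
  · exact absurd hdom he
  · rw [not_or, not_and_or] at he
    refine ⟨?_, he.1⟩
    rcases he.2 with h | h
    · exact Or.inl h
    · right; simpa using h

/-! ## The arms of a strand -/

/-- **The arms of a strand under Dobrushin boundary conditions** (registered sub-goal
`ufrs_strandArms` of stmt-CriticalPhenomena-11387; item 3 of the UFRS road map, dictionary part).
For admissible data `E`, a configuration `ω` and a stretch `O c [i, j]` of an orbit of the completed
configuration `E.bcBondConfig ω` through INNER faces of `E`: on its LEFT a walk of lattice sites
through left vertices of the stretch whose edges are domain edges, each `ω`-open or wired and none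
touching the free arc; on its RIGHT a walk of inner faces through right faces of the stretch whose
steps cross (`sepEdge`) domain edges, each `ω`-closed or touching the free arc, none wired. -/
theorem ufrs_strandArms : ∀ (E : DiscreteDobrushin), E.IsZdAdmissible → ∀ (ω : BondConfig (Site 2)) (c : Site 2 × Fin 4) (i j : ℕ), i ≤ j → (∀ t, i ≤ t → t ≤ j → E.IsInnerFace (cFace (cornerOrbit (E.bcBondConfig ω) c t))) → (∃ P : (zdGraph 2).Walk (cornerOrbit (E.bcBondConfig ω) c i).1 (cornerOrbit (E.bcBondConfig ω) c j).1, (∀ x ∈ P.support, ∃ t, i ≤ t ∧ t ≤ j ∧ x = (cornerOrbit (E.bcBondConfig ω) c t).1) ∧ (∀ e ∈ P.edges, e ∈ (discreteDomainGraph E.Ω E.δ).edgeSet ∧ (e ∈ ω ∨ ∀ x ∈ e, x ∈ E.zdArcA) ∧ ∀ x ∈ e, x ∉ E.zdArcB)) ∧ (∃ Q : (zdGraph 2).Walk (cFace (cornerOrbit (E.bcBondConfig ω) c i)) (cFace (cornerOrbit (E.bcBondConfig ω) c j)), (∀ f ∈ Q.support, E.IsInnerFace f ∧ ∃ t, i ≤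 t ∧ t ≤ j ∧ f = cFace (cornerOrbit (E.bcBondConfig ω) c t)) ∧ (∀ d ∈ Q.darts, sepEdge d.fst d.snd ∈ (discreteDomainGraph E.Ω E.δ).edgeSet ∧ (sepEdge d.fst d.snd ∉ ω ∨ ∃ x ∈ sepEdge d.fst d.snd, x ∈ E.zdArcB) ∧ ¬ ∀ x ∈ sepEdge d.fst d.snd, x ∈ E.zdArcA)) := by
  intro E hE ω c i j hij hinner
  obtain ⟨⟨P, hPs, hPe⟩, ⟨Q, hQs, hQd⟩⟩ := exists_orbitArms (E.bcBondConfig ω) c i j hij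
  refine ⟨⟨P, hPs, fun e he => ?_⟩, ⟨Q, fun f hf => ?_, fun d hd => ?_⟩⟩
  · obtain ⟨t, -, -, rfl, hmem⟩ := hPe e he
    exact mem_bcBondConfig_cases hE hmem
  · obtain ⟨t, h1, h2, rfl⟩ := hQs f hf
    exact ⟨hinner t h1 h2, t, h1, h2, rfl⟩
  · obtain ⟨t, h1, h2, hsep, hclosed⟩ := hQd d hd
    rw [hsep]
    have hdom := cTgt_mem_edgeSet_of_isInnerFace (hinner t h1 h2.le)
    exact ⟨hdom, not_mem_bcBondConfig_cases hdom hclosed⟩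

/-! ## The arms are long -/

/-- **Strands from the collar to the ball are long.** If the vertex `x` is in the `3η`-collar
(`infDist (E.δ x) Ωᶜ < 3η`) and the corner `p` has its target midpoint in the ball `B(E.δ v, ρ)`
whose centre is `2ρ`-deep, then `E.δ p.1` is at euclidean distance `> ρ - 3η - E.δ` from `E.δ x`. -/
theorem far_of_cTgt_mem_ball {E : DiscreteDobrushin} {Ω : Set ℂ} {v x : Site 2} {ρ η : ℝ} (hδ : 0 ≤ E.δ)
    (hv : 2 * ρ ≤ infDist (meshPoint E.δ v) Ωᶜ) (hx : infDist (meshPoint E.δ x) Ωᶜ < 3 * η)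
    {p : Site 2 × Fin 4} (hp : medialPoint E.δ (cTgt p) ∈ ball (meshPoint E.δ v) ρ) :
    ρ - 3 * η - E.δ < dist (meshPoint E.δ p.1) (meshPoint E.δ x) := by
  have h1 := dist_medialPoint_cTgt_le' hδ p
  have h2 := dist_triangle (meshPoint E.δ p.1) (medialPoint E.δ (cTgt p)) (meshPoint E.δ v)
  rw [dist_comm] at h1
  rw [mem_ball] at hp
  have h3 := infDist_le_infDist_add_dist (x := meshPoint E.δ v) (y := meshPoint E.δ p.1) (s := Ωᶜ)
  have h4 := infDist_le_infDist_add_dist (x := meshPoint E.δ p.1) (y := meshPoint E.δ x) (s := Ωᶜ)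
  rw [dist_comm] at h3
  linarith

/-- The same for a corner whose SOURCE midpoint lies in the ball (an exit corner of the ball, the
start of a whisker). -/
theorem far_of_cSrc_mem_ball {E : DiscreteDobrushin} {Ω : Set ℂ} {v x : Site 2} {ρ η : ℝ} (hδ : 0 ≤ E.δ)
    (hv : 2 * ρ ≤ infDist (meshPoint E.δ v) Ωᶜ) (hx : infDist (meshPoint E.δ x) Ωᶜ < 3 * η)
    {p : Site 2 × Fin 4} (hp : medialPoint E.δ (cSrc p) ∈ ball (meshPoint E.δ v) ρ) :
    ρ - 3 * η - E.δ < dist (meshPoint E.δ p.1) (meshPoint E.δ x) := by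
  have h1 := dist_medialPoint_cSrc_le' hδ p
  have h2 := dist_triangle (meshPoint E.δ p.1) (medialPoint E.δ (cSrc p)) (meshPoint E.δ v)
  rw [dist_comm] at h1
  rw [mem_ball] at hp
  have h3 := infDist_le_infDist_add_dist (x := meshPoint E.δ v) (y := meshPoint E.δ p.1) (s := Ωᶜ)
  have h4 := infDist_le_infDist_add_dist (x := meshPoint E.δ p.1) (y := meshPoint E.δ x) (s := Ωᶜ)
  rw [dist_comm] at h3
  linarith

end

end Summit.CriticalPhenomena.CardyFormulaZ2.Cruxes.EdgePrecompact.QkzStripBoundaryArm
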